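import Literature.NumberTheory.LFunctions.Zhang2022.Section8ProfileSjBounds
import Literature.NumberTheory.LFunctions.Zhang2022.AppendixALemma83RelHolds
import HarnessLib

/-!
# Zhang (2022) §8 for profile data: the FIVE ERROR TERMS of the gathering at a fixed modulus (good range, sliver, engine,
# jets, tail), each `≤ K·𝓛⁻¹`, the scales at a large modulus, and the final algebraic decomposition of `α⁻¹S_j − 𝔪_j𝔞`

Topic `Literature/NumberTheory/LFunctions/Zhang2022` (Landau–Siegel audit tree; verdict-neutral). Y. Zhang, *Discrete mean
estimates and the Landau–Siegel zero*, arXiv:2211.02515v1 (2022) [Zhang2022LandauSiegel] — **an unrefereed manuscript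
under adjudication; nothing here asserts or denies its Theorems 1–2; no claim about Landau–Siegel zeros.** Cell
landau-siegel §D, crux K0 = stmt-Parity-20459 `InClassSideTablesPiece` (line «sjrows», stub `stub_sjRows`: the row (S)
`KnifeEdge.SjProfileRow`, p537807), prover ls-knife-K0-p1 g2. This file GATHERS (Zhang's «Gathering these results together
we conclude, by simple approximation … substituting `n = dr` … it follows by partial integration», §8 pp. 47–48, for a general
`C²` profile in place of `ϰ₁`): the exact form (`Sj_profTable_eq_split`), the good range (`good_range_bound`: LEMMA A
`psiRow_C2` × LEMMA A* `antiRow_C2` with Lemma 8.4 in the relative form of record `lemma84Rel_holds` and the `ξ₀` log-mean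
`xiZeroLogMean_le`), the sliver (`sliver_range_bound`), (8.10) (`mainDouble_eq`), the range-sum engine
(`Section8RangeEngine.weighted_sum_integral_eval`), the substitution `t = e^{zΛ}`, and the jet dictionary
(`Section8DipoleJets`) — every error `≤ K·𝓛⁻¹` (`Section8ProfileSjBounds`), `𝔞 ≥ a₀` under (A) (`frakALowerBound_holds`).

* `two_mul_rpow11_le_sq`, `scales_large` — the numeric facts at `𝓛 ≥ max(4, 4/θ, 2/(1−θ)+1)`;
* `final_identity` — `α⁻¹S − 𝔪𝔞 = α⁻¹(G − MD) + α⁻¹Sl − α⁻¹Λ⁻²(Es − I) − π⁻¹𝔞(Φ_θ − JK_θ) + π⁻¹𝔞·tail`;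
* `goodTerm_le`, `errGood_le`, `sliverTerm_le`, `engineTerm_le`, `jetTerm_le`, `tailTerm_le` — the five terms.
The assembly `sjProfileRow_C2` is in `Section8ProfileSjRow`.

## References
* Y. Zhang, arXiv:2211.02515v1 (2022), §7 Prop 7.1; §8 Lemmas 8.2–8.4, (8.10)–(8.12), pp. 47–48.
  [cite: Zhang2022LandauSiegel, §8 pp.47–48]
-/

noncomputable section

open Complex Real MeasureTheory Set intervalIntegral Filter Finset
open scoped ComplexConjugate Topology

namespace Literature.NumberTheory.LFunctions.Zhang2022.DipoleRule

open Skeleton KnifeEdge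

/-! ### Numeric facts at a large modulus -/

/-- `2𝓛^{1.1} ≤ 𝓛²` for `𝓛 ≥ 4` (`𝓛^{1.1} ≤ 𝓛^{3/2} = 𝓛√𝓛` and `2√𝓛 ≤ 𝓛`). [cite: Zhang2022LandauSiegel, §6 p.12] -/
theorem two_mul_rpow11_le_sq {ℓ : ℝ} (hℓ : 4 ≤ ℓ) : 2 * ℓ ^ (11 / 10 : ℝ) ≤ ℓ ^ 2 := by
  have hℓ0 : 0 ≤ ℓ := by linarith
  have hℓ1 : 1 ≤ ℓ := by linarith
  have h1 : ℓ ^ (11 / 10 : ℝ) ≤ ℓ ^ (3 / 2 : ℝ) := Real.rpow_le_rpow_of_exponent_le hℓ1 (by norm_num)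
  have h2 : ℓ ^ (3 / 2 : ℝ) = ℓ * Real.sqrt ℓ := by
    rw [show (3 / 2 : ℝ) = 1 + 1 / 2 by norm_num, Real.rpow_add (by linarith), Real.rpow_one, Real.sqrt_eq_rpow]
  have h3 : 2 ≤ Real.sqrt ℓ := by
    rw [show (2 : ℝ) = Real.sqrt 4 by rw [show (4:ℝ) = 2 ^ 2 by norm_num, Real.sqrt_sq (by norm_num)]]
    exact Real.sqrt_le_sqrt hℓ
  have h4 : Real.sqrt ℓ * Real.sqrt ℓ = ℓ := Real.mul_self_sqrt hℓ0
  nlinarith [Real.sqrt_nonneg ℓ]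

/-- `⌈exp L₀⌉ ≤ D` gives `L₀ ≤ log D` (the «sufficiently large `D`» of §2 p.4 as a threshold on `𝓛`).
[cite: Zhang2022LandauSiegel, §2 p.4] -/
theorem le_log_of_ceil_exp_le {L₀ : ℝ} {D : ℕ} (hD : ⌈Real.exp L₀⌉₊ ≤ D) : L₀ ≤ Real.log D := by
  have h : Real.exp L₀ ≤ (D : ℝ) := (Nat.le_ceil _).trans (by exact_mod_cast hD)
  exact (Real.le_log_iff_exp_le (lt_of_lt_of_le (Real.exp_pos _) h)).mpr h

/-- **The scales at a large modulus.** For `0 < θ < 1` and `𝓛 ≥ max(4, 4/θ, 2/(1−θ) + 1)`, with `Λ = 𝓛⁹`, `L₁ = 𝓛^{1.1}`,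
`τ₁ = 2L₁/Λ`, `Y = e^{(θ−τ₁)Λ}`: `τ₁ ≤ θ/2`, `2 ≤ Y`, `Y ≤ P`, `log(Y+1) < θΛ`, `e^{θΛ} < ⌈PT⁻²⌉`, `2L₁ ≤ 𝓛²`.
[cite: Zhang2022LandauSiegel, §2 (2.6), §6 p.12, §7 (7.2)] -/
theorem scales_large {θ : ℝ} (hθ0 : 0 < θ) (hθ1 : θ < 1) {D : ℕ} (h4 : 4 ≤ Real.log D)
    (hθℓ : 4 / θ ≤ Real.log D) (h1θ : 2 / (1 - θ) + 1 ≤ Real.log D) :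
    2 * Real.log D ^ (11 / 10 : ℝ) / Real.log D ^ 9 ≤ θ / 2 ∧
    2 ≤ Real.exp ((θ - 2 * Real.log D ^ (11 / 10 : ℝ) / Real.log D ^ 9) * Real.log D ^ 9) ∧
    Real.exp ((θ - 2 * Real.log D ^ (11 / 10 : ℝ) / Real.log D ^ 9) * Real.log D ^ 9) ≤ bigP D ∧
    Real.log (Real.exp ((θ - 2 * Real.log D ^ (11 / 10 : ℝ) / Real.log D ^ 9) * Real.log D ^ 9) + 1)
      < θ * Real.log D ^ 9 ∧
    Real.exp (θ * Real.log D ^ 9) < Nsupp D ∧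
    2 * Real.log D ^ (11 / 10 : ℝ) ≤ Real.log D ^ 2 := by
  set ℓ := Real.log D with hℓ
  set L₁ := ℓ ^ (11 / 10 : ℝ) with hL₁
  have hℓ1 : 1 ≤ ℓ := by linarith
  have hℓ0 : 0 < ℓ := by linarith
  obtain ⟨hL1ge, hℓL⟩ := rpow11_ge hℓ1
  have h2L : 2 * L₁ ≤ ℓ ^ 2 := two_mul_rpow11_le_sq h4
  have h9 : 0 < ℓ ^ 9 := by positivity
  have hℓ7 : ℓ ≤ ℓ ^ 7 := by
    calc ℓ = ℓ ^ 1 := (pow_one ℓ).symm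
      _ ≤ ℓ ^ 7 := pow_le_pow_right₀ hℓ1 (by norm_num)
  have e9 : ℓ ^ 9 = ℓ ^ 2 * ℓ ^ 7 := by ring
  -- `τ₁ ≤ θ/2`: `4L₁ ≤ 2ℓ² ≤ θℓ⁹` since `θℓ⁷ ≥ θℓ ≥ 4`
  have hθℓ' : 4 ≤ θ * ℓ := by rwa [div_le_iff₀ hθ0, mul_comm] at hθℓ
  have hτ : 2 * L₁ / ℓ ^ 9 ≤ θ / 2 := by
    rw [div_le_iff₀ h9]
    have : θ * ℓ ≤ θ * ℓ ^ 7 := mul_le_mul_of_nonneg_left hℓ7 hθ0.le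
    nlinarith [sq_nonneg ℓ]
  have hτ0 : 0 ≤ 2 * L₁ / ℓ ^ 9 := by positivity
  -- `Y ≥ 2`: exponent `≥ θℓ⁹/2 ≥ 2 > log 2`
  have hexp_ge : 2 ≤ (θ - 2 * L₁ / ℓ ^ 9) * ℓ ^ 9 := by
    have h1 : θ / 2 * ℓ ^ 9 ≤ (θ - 2 * L₁ / ℓ ^ 9) * ℓ ^ 9 := by
      apply mul_le_mul_of_nonneg_right _ h9.le; linarith
    have h2 : (2 : ℝ) ≤ θ / 2 * ℓ ^ 9 := by
      have : θ * ℓ ≤ θ * ℓ ^ 9 := by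
        apply mul_le_mul_of_nonneg_left _ hθ0.le
        calc ℓ = ℓ ^ 1 := (pow_one ℓ).symm
          _ ≤ ℓ ^ 9 := pow_le_pow_right₀ hℓ1 (by norm_num)
      linarith
    linarith
  have hY2 : 2 ≤ Real.exp ((θ - 2 * L₁ / ℓ ^ 9) * ℓ ^ 9) := by
    have : (2 : ℝ) ≤ Real.exp 1 := by have := Real.add_one_le_exp (1:ℝ); linarith
    exact this.trans (Real.exp_le_exp.mpr (by linarith))
  -- `Y ≤ P`
  have hYP : Real.exp ((θ - 2 * L₁ / ℓ ^ 9) * ℓ ^ 9) ≤ bigP D := by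
    rw [bigP, Real.exp_le_exp, ell, ← hℓ]
    nlinarith
  -- `log(Y+1) < θΛ`
  have hlog : Real.log (Real.exp ((θ - 2 * L₁ / ℓ ^ 9) * ℓ ^ 9) + 1) < θ * ℓ ^ 9 := by
    set E := (θ - 2 * L₁ / ℓ ^ 9) * ℓ ^ 9 with hE
    have hY1 : 1 ≤ Real.exp E := by linarith
    have h1 : Real.exp E + 1 ≤ 2 * Real.exp E := by linarith
    have h2 : Real.log (Real.exp E + 1) ≤ Real.log 2 + E := by
      calc Real.log (Real.exp E + 1) ≤ Real.log (2 * Real.exp E) := Real.log_le_log (by positivity) h1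
        _ = Real.log 2 + E := by rw [Real.log_mul (by norm_num) (Real.exp_pos _).ne', Real.log_exp]
    have h3 : Real.log 2 < 2 * L₁ := by
      have := Real.log_two_lt_d9; linarith
    have h4' : E = θ * ℓ ^ 9 - 2 * L₁ := by rw [hE]; field_simp
    linarith
  -- `e^{θΛ} < ⌈P/T²⌉`: `θℓ⁹ < ℓ⁹ − 2L₁`
  have hN : Real.exp (θ * ℓ ^ 9) < Nsupp D := by
    have h1θ' : 2 < (1 - θ) * ℓ := by
      have h1 : 0 < 1 - θ := by linarith
      have : 2 / (1 - θ) < ℓ := by linarith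
      rwa [div_lt_iff₀ h1, mul_comm] at this
    have hkey : θ * ℓ ^ 9 < ℓ ^ 9 - 2 * L₁ := by
      have : (1 - θ) * ℓ ≤ (1 - θ) * ℓ ^ 7 := mul_le_mul_of_nonneg_left hℓ7 (by linarith)
      nlinarith [sq_nonneg ℓ]
    have hPT : bigP D / bigT D ^ 2 = Real.exp (ℓ ^ 9 - 2 * L₁) := by
      have h11 : ℓ ^ (1.1 : ℝ) = L₁ := by rw [hL₁]; norm_num
      rw [bigP, bigT, ell, ← hℓ, h11, ← Real.exp_nat_mul, ← Real.exp_sub]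
      norm_num
    calc Real.exp (θ * ℓ ^ 9) < Real.exp (ℓ ^ 9 - 2 * L₁) := Real.exp_lt_exp.mpr hkey
      _ = bigP D / bigT D ^ 2 := hPT.symm
      _ ≤ Nsupp D := Nat.le_ceil _
  exact ⟨hτ, hY2, hYP, hlog, hN, h2L⟩

/-! ### The final algebraic decomposition -/

/-- **The decomposition of `α⁻¹S_j − 𝔪_j𝔞`:** with `S = G + Sl` (exact split), `MD = −Λ⁻²Es` ((8.10)),
`I = 𝔞·ΛΦ_b` (substitution), `Φ_b = Φ_θ − tail`, `JK₁ = JK_θ`, `𝔪 = −π⁻¹JK₁`, `α⁻¹Λ⁻¹ = π⁻¹`, `Λ⁻¹Λ = 1`: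
`α⁻¹S − 𝔪𝔞 = α⁻¹(G − MD) + α⁻¹Sl − α⁻¹Λ⁻²(Es − I) − π⁻¹𝔞(Φ_θ − JK_θ) + π⁻¹𝔞·tail`.
[cite: Zhang2022LandauSiegel, §8 (8.10)–(8.12) p.48] -/
theorem final_identity {S G Sl MD L2 Es0 Iint Φb Φθ tail JKθ JK1 m αi Λi Λc πi a : ℂ} (hS : S = G + Sl)
    (hMD : MD = -(Λi ^ 2 * L2 * Es0)) (hI : Iint = Λc * Φb) (hΦ : Φb = Φθ - tail) (hJK : JK1 = JKθ)
    (hm : m = -πi * JK1) (hαΛ : αi * Λi = πi) (hΛ : Λi * Λc = 1) :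
    αi * S - m * a = αi * (G - MD) + αi * Sl - αi * Λi ^ 2 * (L2 * Es0 - a * Iint) - πi * a * (Φθ - JKθ)
      + πi * a * tail := by
  rw [hS, hMD, hI, hΦ, hm, hJK]
  linear_combination (-(a * (Φθ - tail) * (αi * Λi))) * hΛ + (-(a * (Φθ - tail))) * hαΛ

/-! ### The five error terms at a fixed modulus, each `≤ K·𝓛⁻¹` -/

/-- **Good range, `×Λ/π`:** `(Λ/π)‖ΣΣ_{n<Y} w(MN − AB)‖ ≤ (4e⁴³⁰/π)·ERR` (`log Y ≤ Λ`, `(1+Λ)/Λ ≤ 2`).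
[cite: Zhang2022LandauSiegel, §8 p.47] -/
theorem goodTerm_le {ℓ E N : ℝ} (hℓ : 1 ≤ ℓ) (hE : 0 ≤ E) {logY : ℝ} (hlogY : logY ≤ ℓ ^ 9) (hlogY0 : 0 ≤ logY)
    (hN : N ≤ 2 * Real.exp 430 * (((ℓ ^ 9) ^ 2)⁻¹ * E) * (1 + logY)) :
    ℓ ^ 9 / π * N ≤ 4 * Real.exp 430 / π * E := by
  have h9 : 1 ≤ ℓ ^ 9 := one_le_pow₀ hℓ
  have h9' : 0 < ℓ ^ 9 := by positivity
  have h1 : ℓ ^ 9 * (((ℓ ^ 9) ^ 2)⁻¹ * (1 + logY)) ≤ 2 := by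
    rw [show ℓ ^ 9 * (((ℓ ^ 9) ^ 2)⁻¹ * (1 + logY)) = (1 + logY) / ℓ ^ 9 by field_simp]
    rw [div_le_iff₀ h9']; linarith
  calc ℓ ^ 9 / π * N ≤ ℓ ^ 9 / π * (2 * Real.exp 430 * (((ℓ ^ 9) ^ 2)⁻¹ * E) * (1 + logY)) :=
        mul_le_mul_of_nonneg_left hN (by positivity)
    _ = 2 * Real.exp 430 / π * E * (ℓ ^ 9 * (((ℓ ^ 9) ^ 2)⁻¹ * (1 + logY))) := by ring
    _ ≤ 2 * Real.exp 430 / π * E * 2 := mul_le_mul_of_nonneg_left h1 (by positivity)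
    _ = 4 * Real.exp 430 / π * E := by ring

/-- **`ERR ≤ K_E·𝓛⁻¹` at a modulus** (the bounds file assembled: `δM₀ ≤ K_M𝓛⁻⁵`, `δN₀ ≤ K_N𝓛⁻³`, `L′ = ‖L′(1,χ)‖ ≤ 4e^{9/2}𝓛²`,
`K₀ ≤ B₁ + 2GB₀ + G²B₀θ`, `J₀ ≤ GB₀ + B₁`). [cite: Zhang2022LandauSiegel, §8 p.47] -/
theorem errGood_le (c' : ℝ) {D : ℕ} [NeZero D] (χ : DirichletCharacter ℂ D) (hprim : χ.IsPrimitive)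
    (hL : 3 ≤ Real.log D) (j : ℕ) {B₀ B₁ B₂ C₈₄ Cξ θ : ℝ} (hB0 : 0 ≤ B₀) (hB1 : 0 ≤ B₁) (hB2 : 0 ≤ B₂)
    (hC84 : 0 ≤ C₈₄) (hCξ : 0 ≤ Cξ) (hθ0 : 0 ≤ θ) :
    errGood c' D j B₀ B₁ B₂ C₈₄ (Cξ * (1 + 2 * Real.log D ^ (11 / 10 : ℝ)) ^ 3) ‖deriv χ.LFunction 1‖ θ
      ≤ ((Lemma82.C82 0 * ((Gbound c' + 1) ^ 2 * (B₀ + B₁ + B₂))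
            + (Gbound c' + 1) ^ 2 * (B₀ + B₁ + B₂) * (2 + 4 * Real.exp (9 / 2)))
          * (4 * Real.exp (9 / 2) * (B₁ + 2 * Gbound c' * B₀ + Gbound c' ^ 2 * (B₀ * θ))
            + (C₈₄ * ((1 + (3 * π / 2 + 1) ^ 2) * (B₀ + B₁ + B₂))
              + 2 * ((3 * π / 2 + 1) ^ 2 * (B₀ + B₁ + B₂))
                * (108 * Cξ + 4 * Real.exp (9 / 2) *
                  (1 + 2 * (Gbound c' ^ 2 / (3 * π / 2) ^ 2) + 2 * ((Gbound c' + 3 * π / 2) ^ 2 / (3 * π / 2))))))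
        + 4 * Real.exp (9 / 2) * (Gbound c' * B₀ + B₁) *
          (C₈₄ * ((1 + (3 * π / 2 + 1) ^ 2) * (B₀ + B₁ + B₂))
            + 2 * ((3 * π / 2 + 1) ^ 2 * (B₀ + B₁ + B₂))
              * (108 * Cξ + 4 * Real.exp (9 / 2) *
                (1 + 2 * (Gbound c' ^ 2 / (3 * π / 2) ^ 2) + 2 * ((Gbound c' + 3 * π / 2) ^ 2 / (3 * π / 2))))))
        / Real.log D := by
  have hℓ1 : 1 ≤ Real.log D := by linarith
  have hℓ0 : 0 < Real.log D := by linarith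
  have hL' : ‖deriv χ.LFunction 1‖ ≤ 4 * Real.exp (9 / 2) * Real.log D ^ 2 :=
    Section8FrontEnd44Sizes.norm_deriv_LFunction_one_le χ hprim hL
  have hL'0 : 0 ≤ ‖deriv χ.LFunction 1‖ := norm_nonneg _
  have hC820 : 0 ≤ Lemma82.C82 0 := by
    unfold Lemma82.C82; have := Lemma82.I0_nonneg; positivity
  have hG0 : 0 ≤ Gbound c' := (Gbound_pos c').le
  have hdM := deltaM0_le c' hL j hB0 hB1 hB2 hL'0 hL'
  have hdN := deltaN0_le c' hL j hB0 hB1 hB2 hC84 hCξ hL'0 hL'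
  have hdM0 : 0 ≤ deltaM0 c' D j B₀ B₁ B₂ ‖deriv χ.LFunction 1‖ := by unfold deltaM0; positivity
  have hdN0 : 0 ≤ deltaN0 c' D j B₀ B₁ B₂ C₈₄ (Cξ * (1 + 2 * Real.log D ^ (11 / 10 : ℝ)) ^ 3) ‖deriv χ.LFunction 1‖ := by
    unfold deltaN0; positivity
  have hK0 : 0 ≤ antiK0 c' D j B₀ B₁ θ := by unfold antiK0; positivity
  have hJ0 : 0 ≤ psiJ0 c' D j B₀ B₁ := by unfold psiJ0; positivity
  have hK : antiK0 c' D j B₀ B₁ θ ≤ B₁ + 2 * Gbound c' * B₀ + Gbound c' ^ 2 * (B₀ * θ) := by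
    unfold antiK0
    have h1 := norm_sigmaJ_le c' hL j
    have h2 := norm_nuJ_le c' hL j
    gcongr
  have hJ : psiJ0 c' D j B₀ B₁ ≤ Gbound c' * B₀ + B₁ := by
    unfold psiJ0
    have h1 := norm_betaJ_mul_le c' hL j
    gcongr
  have key := errGood_le_of hℓ1 hdM0 hdM hdN0 hdN hL'0 hL' hK0 hJ0
  unfold errGood
  refine key.trans ?_
  rw [div_le_div_iff_of_pos_right hℓ0]
  have hKM0 : 0 ≤ Lemma82.C82 0 * ((Gbound c' + 1) ^ 2 * (B₀ + B₁ + B₂))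
      + (Gbound c' + 1) ^ 2 * (B₀ + B₁ + B₂) * (2 + 4 * Real.exp (9 / 2)) := by positivity
  have hKN0 : 0 ≤ C₈₄ * ((1 + (3 * π / 2 + 1) ^ 2) * (B₀ + B₁ + B₂))
      + 2 * ((3 * π / 2 + 1) ^ 2 * (B₀ + B₁ + B₂))
        * (108 * Cξ + 4 * Real.exp (9 / 2) *
          (1 + 2 * (Gbound c' ^ 2 / (3 * π / 2) ^ 2) + 2 * ((Gbound c' + 3 * π / 2) ^ 2 / (3 * π / 2)))) := by
    positivity
  gcongr

/-- **Sliver, `×Λ/π`:** `(Λ/π)‖ΣΣ_{Y≤n<P^θ} wMN‖ ≤ K_S𝓛⁻¹`, `K_S = (8·3⁵e⁴³⁰/π)B₁²C_ξ` (`sliver_range_bound` + `sliverTotal_le`;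
`log(P^θ/Y) = τ₁Λ = 2L₁`). [cite: Zhang2022LandauSiegel, §8 p.47] -/
theorem sliverTerm_le {ℓ θ B₁ Cξ N : ℝ} (hℓ : 3 ≤ ℓ) (hCξ : 0 ≤ Cξ)
    (hN : N ≤ 2 * Real.exp 430 *
        (B₁ ^ 2 * (2 * ℓ ^ (11 / 10 : ℝ) / ℓ ^ 9) ^ 2 * (1 + 2 * ℓ ^ (11 / 10 : ℝ) / ℓ ^ 9 * ℓ ^ 9)
          * (Cξ * (1 + 2 * ℓ ^ (11 / 10 : ℝ)) ^ 3))
        * (1 + Real.log (Real.exp (θ * ℓ ^ 9) / Real.exp ((θ - 2 * ℓ ^ (11 / 10 : ℝ) / ℓ ^ 9) * ℓ ^ 9)))) :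
    ℓ ^ 9 / π * N ≤ 8 * 3 ^ 5 * Real.exp 430 / π * B₁ ^ 2 * Cξ / ℓ := by
  have hℓ0 : 0 < ℓ := by linarith
  have h9 : (ℓ ^ 9) ≠ 0 := by positivity
  have hlog : Real.log (Real.exp (θ * ℓ ^ 9) / Real.exp ((θ - 2 * ℓ ^ (11 / 10 : ℝ) / ℓ ^ 9) * ℓ ^ 9))
      = 2 * ℓ ^ (11 / 10 : ℝ) := by
    rw [Real.log_div (Real.exp_pos _).ne' (Real.exp_pos _).ne', Real.log_exp, Real.log_exp]
    field_simp
    ring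
  rw [hlog] at hN
  have h := sliverTotal_le (B₁ := B₁) hℓ hCξ
  refine le_trans ?_ h
  exact mul_le_mul_of_nonneg_left hN (by positivity)

/-- **Engine, `×Λ⁻¹/π`:** `(Λ/π)Λ⁻²·Cℓ⁶(M + M′ℓ⁹) ≤ (|C|/π)(M₀ + M₁)·𝓛⁻³` when `M ≤ M₀`, `M′ℓ⁹ ≤ M₁`.
[cite: Zhang2022LandauSiegel, §8 (8.11) p.48] -/
theorem engineTerm_le {ℓ C M M' M₀ M₁ N : ℝ} (hℓ : 1 ≤ ℓ) (hM0 : 0 ≤ M) (hM : M ≤ M₀) (hM'0 : 0 ≤ M')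
    (hM' : M' * ℓ ^ 9 ≤ M₁) (hN : N ≤ C * ℓ ^ 6 * (M + M' * ℓ ^ 9)) :
    ℓ ^ 9 / π * (((ℓ ^ 9) ^ 2)⁻¹ * N) ≤ |C| / π * (M₀ + M₁) / ℓ ^ 3 := by
  have hℓ0 : 0 < ℓ := by linarith
  have hN' : N ≤ |C| * ℓ ^ 6 * (M₀ + M₁) := by
    refine hN.trans ?_
    have h1 : C * ℓ ^ 6 * (M + M' * ℓ ^ 9) ≤ |C| * ℓ ^ 6 * (M + M' * ℓ ^ 9) := by
      have : 0 ≤ ℓ ^ 6 * (M + M' * ℓ ^ 9) := by positivity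
      nlinarith [le_abs_self C]
    refine h1.trans ?_
    gcongr
  calc ℓ ^ 9 / π * (((ℓ ^ 9) ^ 2)⁻¹ * N) ≤ ℓ ^ 9 / π * (((ℓ ^ 9) ^ 2)⁻¹ * (|C| * ℓ ^ 6 * (M₀ + M₁))) := by
        gcongr
    _ = |C| / π * (M₀ + M₁) / ℓ ^ 3 := by field_simp

/-- **Jets:** `π⁻¹‖∫₀^θ Φ − ∫₀^θ 𝔧_j𝔪‖ ≤ K_jet·𝓛⁻¹` — the jet gaps of `Section8DipoleJets` are `≤ 15π|c′|α𝓛·B₀`, `30π|c′|α𝓛`,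
`9π²(10|c′|α𝓛 + 25c′²(α𝓛)²)` with `α𝓛 = π𝓛⁻⁸ ≤ π𝓛⁻¹`. [cite: Zhang2022LandauSiegel, §2 (2.13); §8 (8.11)–(8.12)] -/
theorem jetTerm_le (c' : ℝ) {D : ℕ} (hL : 3 ≤ Real.log D) {j : ℕ} (hj : j ∈ ({1, 2, 3} : Finset ℕ))
    {u u' : ℝ → ℂ} {θ : ℝ} (hu : ContinuousOn u (Icc 0 θ)) (hvan : ∀ y : ℝ, θ ≤ y → u y = 0) (hθ0 : 0 ≤ θ)
    (hθ1 : θ ≤ 1) {B₀ B₁ : ℝ} (hB00 : 0 ≤ B₀) (hB0 : ∀ y ∈ Icc 0 θ, ‖u y‖ ≤ B₀)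
    (hB1 : ∀ y ∈ Icc 0 θ, ‖u' y‖ ≤ B₁) :
    1 / π * ‖∫ z in (0:ℝ)..θ, (prodProfile (betaJ c' D j * Real.log D ^ 9) (sigmaJ c' D j) (nuJ c' D j) θ u u' z
        - k0jet j u u' z * k0mass (Repair.bS j) (Repair.bN j) (fun t => conj (u t)) (fun t => conj (u' t)) z)‖
      ≤ (15 * π * |c'| * π * B₀ * (B₁ + 2 * Gbound c' * B₀ + Gbound c' ^ 2 * (B₀ * θ))
          + (B₁ + π * j * B₀) * (30 * π * |c'| * π * B₀
              + 9 * π ^ 2 * (10 * |c'| * π + 25 * c' ^ 2 * π ^ 2) * (B₀ * θ))) * θ / π / Real.log D := by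
  have hℓ0 : 0 < Real.log D := by linarith
  have hℓ1 : 1 ≤ Real.log D := by linarith
  have hℓne : ell D ≠ 0 := hℓ0.ne'
  obtain ⟨-, hαℓ⟩ := alpha_mul_ell9_eq hℓne
  -- `α𝓛 = π/𝓛⁸ ≤ π/𝓛`, `(α𝓛)² ≤ π²/𝓛`
  have hαℓ' : alpha D * ell D = π / Real.log D ^ 8 := hαℓ
  have h8 : (1 : ℝ) ≤ Real.log D ^ 8 := one_le_pow₀ hℓ1
  have hx : alpha D * ell D ≤ π / Real.log D := by
    rw [hαℓ']
    apply div_le_div_of_nonneg_left Real.pi_pos.le hℓ0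
    calc Real.log D = Real.log D ^ 1 := (pow_one _).symm
      _ ≤ Real.log D ^ 8 := pow_le_pow_right₀ hℓ1 (by norm_num)
  have hx0 : 0 ≤ alpha D * ell D := by rw [hαℓ']; positivity
  have hx2 : (alpha D * ell D) ^ 2 ≤ π ^ 2 / Real.log D := by
    have : (alpha D * ell D) ^ 2 ≤ (alpha D * ell D) * π := by
      have hle1 : alpha D * ell D ≤ π := by
        rw [hαℓ']; exact div_le_self Real.pi_pos.le h8
      nlinarith
    calc (alpha D * ell D) ^ 2 ≤ (alpha D * ell D) * π := this
      _ ≤ π / Real.log D * π := mul_le_mul_of_nonneg_right hx Real.pi_pos.le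
      _ = π ^ 2 / Real.log D := by ring
  -- the three gaps
  have hJgap : ∀ y ∈ Icc 0 θ, ‖jetEx (betaJ c' D j * Real.log D ^ 9) u u' y - k0jet j u u' y‖
      ≤ 15 * π * |c'| * π * B₀ / Real.log D := by
    intro y hy
    have h := norm_jet_sub_k0jet_le c' hℓne hj u u' y
    have e : jetEx (betaJ c' D j * Real.log D ^ 9) u u' y = betaJ c' D j * ((ell D ^ 9 : ℝ) : ℂ) * u y + u' y := by
      unfold jetEx ell; push_cast; ring
    rw [e]
    refine h.trans ?_
    calc 15 * π * |c'| * (alpha D * ell D) * ‖u y‖ ≤ 15 * π * |c'| * (π / Real.log D) * B₀ := by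
          gcongr; exact hB0 y hy
      _ = 15 * π * |c'| * π * B₀ / Real.log D := by ring
  have hσ : ‖sigmaJ c' D j - I * π * ((Repair.bS j : ℝ) : ℂ)‖ ≤ 30 * π * |c'| * π / Real.log D := by
    have h := norm_betaSum_mul_sub_le c' hℓne hj
    have e : sigmaJ c' D j = (betaJ c' D (j + 1) + betaJ c' D (j + 2)) * ((ell D ^ 9 : ℝ) : ℂ) := rfl
    rw [e]
    refine h.trans ?_
    calc 30 * π * |c'| * (alpha D * ell D) ≤ 30 * π * |c'| * (π / Real.log D) := by gcongr
      _ = _ := by ring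
  have hν : ‖nuJ c' D j + (π : ℂ) ^ 2 * ((Repair.bN j : ℝ) : ℂ)‖
      ≤ 9 * π ^ 2 * (10 * |c'| * π + 25 * c' ^ 2 * π ^ 2) / Real.log D := by
    have h := norm_betaProd_mul_add_le c' hℓne hj
    have e : nuJ c' D j = betaJ c' D (j + 1) * ((ell D ^ 9 : ℝ) : ℂ) * (betaJ c' D (j + 2) * ((ell D ^ 9 : ℝ) : ℂ)) := rfl
    rw [e]
    refine h.trans ?_
    have h1 : 10 * |c'| * (alpha D * ell D) + 25 * c' ^ 2 * (alpha D * ell D) ^ 2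
        ≤ (10 * |c'| * π + 25 * c' ^ 2 * π ^ 2) / Real.log D := by
      rw [add_div]
      refine add_le_add ?_ ?_
      · calc 10 * |c'| * (alpha D * ell D) ≤ 10 * |c'| * (π / Real.log D) := by gcongr
          _ = _ := by ring
      · calc 25 * c' ^ 2 * (alpha D * ell D) ^ 2 ≤ 25 * c' ^ 2 * (π ^ 2 / Real.log D) := by gcongr
          _ = _ := by ring
    calc 9 * π ^ 2 * (10 * |c'| * (alpha D * ell D) + 25 * c' ^ 2 * (alpha D * ell D) ^ 2)
        ≤ 9 * π ^ 2 * ((10 * |c'| * π + 25 * c' ^ 2 * π ^ 2) / Real.log D) := by gcongr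
      _ = _ := by ring
  have key := norm_integral_prodProfile_sub_k0_le (γ := betaJ c' D j * Real.log D ^ 9) (σ := sigmaJ c' D j)
    (ν := nuJ c' D j) (j := j) (s := Repair.bS j) (N := Repair.bN j) hu hvan hθ0 hθ1 hB0 hB1 hJgap hσ hν
  have hK : B₁ + ‖sigmaJ c' D j‖ * B₀ + ‖nuJ c' D j‖ * (B₀ * θ) ≤ B₁ + 2 * Gbound c' * B₀ + Gbound c' ^ 2 * (B₀ * θ) := by
    have h1 := norm_sigmaJ_le c' hL j
    have h2 := norm_nuJ_le c' hL j
    gcongr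
  have hB10 : 0 ≤ B₁ := by
    have := hB1 0 ⟨le_rfl, hθ0⟩; exact (norm_nonneg _).trans this
  have hJk0 : 0 ≤ B₁ + π * j * B₀ := by positivity
  have hεJ0 : 0 ≤ 15 * π * |c'| * π * B₀ / Real.log D := by positivity
  rw [one_div, inv_mul_le_iff₀ Real.pi_pos]
  refine key.trans ?_
  have e : π * ((15 * π * |c'| * π * B₀ * (B₁ + 2 * Gbound c' * B₀ + Gbound c' ^ 2 * (B₀ * θ))
      + (B₁ + π * j * B₀) * (30 * π * |c'| * π * B₀
          + 9 * π ^ 2 * (10 * |c'| * π + 25 * c' ^ 2 * π ^ 2) * (B₀ * θ))) * θ / π / Real.log D)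
      = (15 * π * |c'| * π * B₀ / Real.log D * (B₁ + 2 * Gbound c' * B₀ + Gbound c' ^ 2 * (B₀ * θ))
          + (B₁ + π * j * B₀) * (30 * π * |c'| * π / Real.log D * B₀
            + 9 * π ^ 2 * (10 * |c'| * π + 25 * c' ^ 2 * π ^ 2) / Real.log D * (B₀ * θ))) * θ := by
    field_simp
  rw [e]
  gcongr

/-- **Tail:** `π⁻¹‖∫_{θ−τ₁}^θ Φ‖ ≤ (2J₀K₀/π)·𝓛⁻¹` (`τ₁ = 2L₁/Λ ≤ 2/𝓛`). [cite: Zhang2022LandauSiegel, §8 (8.11) p.48] -/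
theorem tailTerm_le {ℓ J K N : ℝ} (hℓ : 1 ≤ ℓ) (hJ : 0 ≤ J) (hK : 0 ≤ K)
    (hN : N ≤ (ℓ ^ (11 / 10 : ℝ) * 2 / ℓ ^ 9) * (J * K)) :
    1 / π * N ≤ 2 * (J * K) / π / ℓ := by
  have hℓ0 : 0 < ℓ := by linarith
  have hL11 : ℓ ^ (11 / 10 : ℝ) ≤ ℓ ^ 2 := by simpa using rpow11_pow_le hℓ (b := 1) (by norm_num)
  have h1 : ℓ ^ (11 / 10 : ℝ) * 2 / ℓ ^ 9 ≤ 2 / ℓ := by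
    rw [div_le_div_iff₀ (by positivity) hℓ0]
    have h7 : ℓ ^ 2 * ℓ ≤ ℓ ^ 9 := by
      calc ℓ ^ 2 * ℓ = ℓ ^ 3 := by ring
        _ ≤ ℓ ^ 9 := pow_le_pow_right₀ hℓ (by norm_num)
    nlinarith
  calc 1 / π * N ≤ 1 / π * ((ℓ ^ (11 / 10 : ℝ) * 2 / ℓ ^ 9) * (J * K)) :=
        mul_le_mul_of_nonneg_left hN (by positivity)
    _ ≤ 1 / π * (2 / ℓ * (J * K)) := by gcongr
    _ = 2 * (J * K) / π / ℓ := by field_simp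

end Literature.NumberTheory.LFunctions.Zhang2022.DipoleRule

end
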